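import Mathlib
import Summits.Ventures.PercRepro2.OneTypedEdge
import Summits.Ventures.PercRepro2.TypedRow23

/-!
# The weighted one-edge rows (W-ROW-23) and (W-ROW-MIN), and the one-edge induction for (HCOV)
(blind cell PercRepro2, night-3 g20, 2026-08-28; `proofs/NIGHT3-CERT.md` §29)

Along one edge `e` the cubic form is a cubic in `p_e` (`triSum_pin`):

  `Gc(p) = (1 − p_e)³ · Gc(p[e := 0]) + p_e³ · Gc(p[e := 1]) + T₁(p) + T₂(p)`,

`T_k(p) = triSum p {e} (τ[e := k]) K₃` the typed sum with ONE typed edge `e` of type `k` and every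
other edge weighted (`T_k = p_e^k (1 − p_e)^{3−k} · N_k(p)`, `N_k` the one-variable Bernstein
coefficient). The two CANDIDATE rows of this file compare these one-typed-edge sums with the
deletion `Gc(p[e := 0])` and the contraction `Gc(p[e := 1])`:

* **(W-ROW-23)** `WRow23`: `p_e² (1 − p_e) · Gc(p[e := 1]) ≤ T₂(p)` (i.e. `N₂ ≥ N₃`);
* **(W-ROW-MIN)** `WRowMin`: `p_e (1 − p_e)² · Gc(p[e := 0]) ≤ T₁(p)` or
  `p_e (1 − p_e)² · Gc(p[e := 1]) ≤ T₁(p)` (i.e. `N₁ ≥ min (N₀, N₃)`).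

Both are `def`s (Props), CANDIDATES, NOT claimed proved (census: 0 failures on 8,805 nonzero random
weighted rows, exact rationals, this seat). (W-ROW-23) is implied by the typed row (ROW-23) of
`TypedRow23.lean` on every minor (a nonnegative combination of typed rows); (W-ROW-MIN) is NOT
formally implied by the typed (ROW-MIN) (the disjunction is taken per instance, not per minor).

**`HCov_of_wrows`**: (W-ROW-23) ∧ (W-ROW-MIN) ⟹ (HCOV) for every admissible weight vector — by
induction on the number of fractional edges: with the deletion and the contraction nonnegative, the
two rows make the two middle Bernstein coefficients nonnegative, and the empty instance vanishes
(`K3_diag`). So the crux of record needs only ONE typed edge at a time.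

**`wrow23_of_row23`**: the typed row (ROW-23) of `TypedRow23.lean` on every minor implies
(W-ROW-23) — the typed sum with one typed edge expands, by the pinning recursion in the other
edges, into a nonnegative combination of typed rows (`wrow23_aux`: the general statement with a
typed set `F ∋ e`, induction on the fractional edges). Own work; standard axioms.
-/

namespace Summit.Ventures.PercRepro2

open UnionCluster

namespace CovForm

section Defs

variable {V : Type*} {E : Type*} [Fintype E] [DecidableEq E] {R : Type*} [Field R]
  [LinearOrder R] [IsStrictOrderedRing R]

/-- **(W-ROW-23), a CANDIDATE (not claimed proved)**: for every admissible weight vector and every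
edge `e`, the typed sum with the single typed edge `e` of type `2` dominates `p_e² (1 − p_e)` times
the cubic form of the contraction `p[e := 1]`. -/
def WRow23 (ends : E → Sym2 V) (o a₁ a₂ a₃ b : V) : Prop :=
  ∀ (p : E → R), IsProbVec p → ∀ (e : E) (τ : E → ℕ),
    p e ^ 2 * (1 - p e) * Gc (Function.update p e 1) ends o a₁ a₂ a₃ b ≤
      triSum p {e} (Function.update τ e 2) (K3 ends o a₁ a₂ a₃ b)

/-- **(W-ROW-MIN), a CANDIDATE (not claimed proved)**: for every admissible weight vector and every
edge `e`, the typed sum with the single typed edge `e` of type `1` dominates `p_e (1 − p_e)²` times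
the cubic form of the deletion `p[e := 0]` or `p_e (1 − p_e)²` times the cubic form of the
contraction `p[e := 1]`. -/
def WRowMin (ends : E → Sym2 V) (o a₁ a₂ a₃ b : V) : Prop :=
  ∀ (p : E → R), IsProbVec p → ∀ (e : E) (τ : E → ℕ),
    p e * (1 - p e) ^ 2 * Gc (Function.update p e 0) ends o a₁ a₂ a₃ b ≤
        triSum p {e} (Function.update τ e 1) (K3 ends o a₁ a₂ a₃ b) ∨
      p e * (1 - p e) ^ 2 * Gc (Function.update p e 1) ends o a₁ a₂ a₃ b ≤
        triSum p {e} (Function.update τ e 1) (K3 ends o a₁ a₂ a₃ b)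

end Defs

namespace WRows

open OneTyped

section Main

variable {V : Type*} {E : Type*} [Fintype E] [DecidableEq E] {R : Type*} [Field R]
  [LinearOrder R] [IsStrictOrderedRing R]
variable (ends : E → Sym2 V) (o a₁ a₂ a₃ b : V)

/-- With every edge pinned the cubic form vanishes: `Gc(p) = K₃(z, z, z) = 0`. -/
theorem Gc_eq_zero_of_pinned (p : E → R) (hp : ∀ e, p e = 0 ∨ p e = 1) :
    Gc p ends o a₁ a₂ a₃ b = 0 := by
  classical
  rw [hcov_cubic p ends o a₁ a₂ a₃ b (fun _ => 0),
    triSum_pinned_eq p ∅ (fun e _ => hp e) (fun _ => 0), typedCount_empty, K3_diag, mul_zero]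

/-- **The one-edge induction step**: if the deletion and the contraction at `e` have nonnegative
cubic forms, (W-ROW-23) and (W-ROW-MIN) at `e` give a nonnegative cubic form. -/
theorem Gc_nonneg_of_minors (h23 : WRow23 (R := R) ends o a₁ a₂ a₃ b)
    (hmin : WRowMin (R := R) ends o a₁ a₂ a₃ b) (p : E → R) (hp : IsProbVec p) (e : E)
    (hdel : 0 ≤ Gc (Function.update p e 0) ends o a₁ a₂ a₃ b)
    (hcon : 0 ≤ Gc (Function.update p e 1) ends o a₁ a₂ a₃ b) :
    0 ≤ Gc p ends o a₁ a₂ a₃ b := by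
  rw [hcov_cubic p ends o a₁ a₂ a₃ b (fun _ => 0),
    triSum_pin p (Finset.notMem_empty e) (fun _ => 0) (K3 ends o a₁ a₂ a₃ b),
    Finset.insert_empty, ← hcov_cubic, ← hcov_cubic]
  have hpe := hp.nonneg e
  have hpe' : 0 ≤ 1 - p e := sub_nonneg.mpr (hp.le_one e)
  have h0 : 0 ≤ (1 - p e) ^ 3 * Gc (Function.update p e 0) ends o a₁ a₂ a₃ b :=
    mul_nonneg (pow_nonneg hpe' 3) hdel
  have h3 : 0 ≤ p e ^ 3 * Gc (Function.update p e 1) ends o a₁ a₂ a₃ b :=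
    mul_nonneg (pow_nonneg hpe 3) hcon
  have h2 : 0 ≤ triSum p {e} (Function.update (fun _ => 0) e 2) (K3 ends o a₁ a₂ a₃ b) :=
    le_trans (mul_nonneg (mul_nonneg (pow_nonneg hpe 2) hpe') hcon) (h23 p hp e (fun _ => 0))
  have h1 : 0 ≤ triSum p {e} (Function.update (fun _ => 0) e 1) (K3 ends o a₁ a₂ a₃ b) := by
    rcases hmin p hp e (fun _ => 0) with h | h
    · exact le_trans (mul_nonneg (mul_nonneg hpe (pow_nonneg hpe' 2)) hdel) h
    · exact le_trans (mul_nonneg (mul_nonneg hpe (pow_nonneg hpe' 2)) hcon) h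
  linarith

/-- **(HCOV) from the weighted one-edge rows**: (W-ROW-23) ∧ (W-ROW-MIN) give `0 ≤ Gc(p)` for every
admissible weight vector, by induction on the number of fractional edges. -/
theorem Gc_nonneg_of_wrows (h23 : WRow23 (R := R) ends o a₁ a₂ a₃ b)
    (hmin : WRowMin (R := R) ends o a₁ a₂ a₃ b) (p : E → R) (hp : IsProbVec p) :
    0 ≤ Gc p ends o a₁ a₂ a₃ b := by
  classical
  generalize hn : (triFracFree p ∅).card = n
  induction n using Nat.strong_induction_on generalizing p with
  | _ n ih =>
    by_cases h0 : triFracFree p ∅ = ∅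
    · have hpin : ∀ e, p e = 0 ∨ p e = 1 := by
        intro e
        by_contra hc
        rw [not_or] at hc
        have : e ∈ triFracFree p ∅ :=
          mem_triFracFree.mpr ⟨Finset.notMem_empty e, hc.1, hc.2⟩
        rw [h0] at this
        exact absurd this (Finset.notMem_empty e)
      rw [Gc_eq_zero_of_pinned ends o a₁ a₂ a₃ b p hpin]
    · obtain ⟨e, he⟩ := Finset.nonempty_iff_ne_empty.mpr h0
      have hlt : ((triFracFree p ∅).erase e).card < n := by
        rw [← hn]
        exact Finset.card_erase_lt_of_mem he
      have hc0 : (triFracFree (Function.update p e 0) ∅).card =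
          ((triFracFree p ∅).erase e).card := by
        rw [triFracFree_update p ∅ e 0 (Or.inl rfl)]
      have hc1 : (triFracFree (Function.update p e 1) ∅).card =
          ((triFracFree p ∅).erase e).card := by
        rw [triFracFree_update p ∅ e 1 (Or.inr rfl)]
      exact Gc_nonneg_of_minors ends o a₁ a₂ a₃ b h23 hmin p hp e
        (ih _ hlt _ (hp.update e le_rfl zero_le_one) hc0)
        (ih _ hlt _ (hp.update e zero_le_one le_rfl) hc1)

/-- **(HCOV) from (W-ROW-23) and (W-ROW-MIN)** for every admissible weight vector: the crux of
record needs one typed edge at a time. -/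
theorem HCov_of_wrows (h23 : WRow23 (R := R) ends o a₁ a₂ a₃ b)
    (hmin : WRowMin (R := R) ends o a₁ a₂ a₃ b) (p : E → R) (hp : IsProbVec p) :
    HCov p ends o a₁ a₂ a₃ b :=
  Gc_nonneg_of_wrows ends o a₁ a₂ a₃ b h23 hmin p hp

end Main

end WRows

namespace WRows

section OfTyped

variable {V : Type*} {E : Type*} [Fintype E] [DecidableEq E] {R : Type*} [Field R]
  [LinearOrder R] [IsStrictOrderedRing R]
variable (ends : E → Sym2 V) (o a₁ a₂ a₃ b : V)

omit [Fintype E] [IsStrictOrderedRing R] in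
/-- The pinned configuration of `p[e := 1]` is the pinned configuration of `p` with `e` open. -/
lemma pinnedConfig_update_one' (p : E → R) (e : E) :
    pinnedConfig (Function.update p e 1) = Function.update (pinnedConfig p) e true := by
  funext f
  by_cases hf : f = e
  · subst hf
    simp [pinnedConfig]
  · simp [pinnedConfig, Function.update_of_ne hf]

/-- **(W-ROW-23) with a typed set, from (ROW-23)**: for `e ∈ F` of type `2` (types in `{1, 2}` on
`F`) and every admissible weight vector, `p_e² (1 − p_e)` times the typed sum of the contraction
`(p[e := 1], F ∖ e)` is at most the typed sum of `(p, F)`. Induction on the fractional edges off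
`F`; at the pinned end this is the typed row on the minor. -/
theorem wrow23_aux (h23 : Row23 (R := R) ends o a₁ a₂ a₃ b) (p : E → R) (hp : IsProbVec p)
    (F : Finset E) (τ : E → ℕ) (e : E) (he : e ∈ F) (hτe : τ e = 2)
    (hτ : ∀ f ∈ F, τ f = 1 ∨ τ f = 2) :
    p e ^ 2 * (1 - p e) * triSum (Function.update p e 1) (F.erase e) τ (K3 ends o a₁ a₂ a₃ b) ≤
      triSum p F τ (K3 ends o a₁ a₂ a₃ b) := by
  classical
  generalize hn : (triFracFree p F).card = n
  induction n using Nat.strong_induction_on generalizing p F τ with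
  | _ n ih =>
    by_cases h0 : triFracFree p F = ∅
    · -- every edge off `F` is pinned: the typed row on the minor `(F, pinnedConfig p)`
      have hpin : ∀ f, f ∉ F → p f = 0 ∨ p f = 1 := by
        intro f hf
        by_contra hc
        rw [not_or] at hc
        have : f ∈ triFracFree p F := mem_triFracFree.mpr ⟨hf, hc.1, hc.2⟩
        rw [h0] at this
        exact absurd this (Finset.notMem_empty f)
      have hpin' : ∀ f, f ∉ F.erase e → Function.update p e 1 f = 0 ∨
          Function.update p e 1 f = 1 := by
        intro f hf
        by_cases hfe : f = e
        · subst hfe; simp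
        · rw [Function.update_of_ne hfe]
          exact hpin f (fun h => hf (Finset.mem_erase.mpr ⟨hfe, h⟩))
      rw [triSum_pinned_eq p F hpin τ, triSum_pinned_eq _ (F.erase e) hpin' τ,
        pinnedConfig_update_one']
      have hprod : (∏ f ∈ F.erase e, Function.update p e 1 f ^ τ f *
          (1 - Function.update p e 1 f) ^ (3 - τ f)) =
          ∏ f ∈ F.erase e, p f ^ τ f * (1 - p f) ^ (3 - τ f) :=
        Finset.prod_congr rfl fun f hf => by
          rw [Function.update_of_ne (Finset.ne_of_mem_erase hf)]
      rw [hprod, ← Finset.mul_prod_erase F _ he, hτe]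
      have hrow := h23 F (pinnedConfig p) τ e he hτe hτ
      rw [Row23Red.typedCount_update_three F e he] at hrow
      have hnn : 0 ≤ p e ^ 2 * (1 - p e) ^ (3 - 2) *
          ∏ f ∈ F.erase e, p f ^ τ f * (1 - p f) ^ (3 - τ f) :=
        mul_nonneg (mul_nonneg (pow_nonneg (hp.nonneg e) 2)
          (pow_nonneg (sub_nonneg.mpr (hp.le_one e)) _))
          (prod_typed_factors_nonneg p (fun f => ⟨hp.nonneg f, hp.le_one f⟩) _ τ)
      have := mul_le_mul_of_nonneg_left hrow hnn
      calc p e ^ 2 * (1 - p e) * ((∏ f ∈ F.erase e, p f ^ τ f * (1 - p f) ^ (3 - τ f)) *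
              typedCount (F.erase e) (Function.update (pinnedConfig p) e true) τ
                (K3 ends o a₁ a₂ a₃ b))
          = p e ^ 2 * (1 - p e) ^ (3 - 2) * (∏ f ∈ F.erase e, p f ^ τ f * (1 - p f) ^ (3 - τ f)) *
              typedCount (F.erase e) (Function.update (pinnedConfig p) e true) τ
                (K3 ends o a₁ a₂ a₃ b) := by ring
        _ ≤ p e ^ 2 * (1 - p e) ^ (3 - 2) * (∏ f ∈ F.erase e, p f ^ τ f * (1 - p f) ^ (3 - τ f)) *
              typedCount F (pinnedConfig p) τ (K3 ends o a₁ a₂ a₃ b) := this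
        _ = _ := by ring
    · -- split at a fractional edge `f ∉ F` on both sides and apply the induction hypothesis
      obtain ⟨f, hf⟩ := Finset.nonempty_iff_ne_empty.mpr h0
      obtain ⟨hfF, hf0, hf1⟩ := mem_triFracFree.mp hf
      have hfe : f ≠ e := fun h => hfF (h ▸ he)
      have hef : e ≠ f := fun h => hfe h.symm
      have hlt : ((triFracFree p F).erase f).card < n := by
        rw [← hn]
        exact Finset.card_erase_lt_of_mem hf
      have hfF' : f ∉ F.erase e := fun h => hfF (Finset.mem_of_mem_erase h)
      rw [triSum_pin p hfF τ, triSum_pin _ hfF' τ, Function.update_of_ne hfe,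
        Function.update_comm hef, Function.update_comm hef, ← Finset.erase_insert_of_ne hfe]
      -- the four pieces
      have hτ1 : ∀ g ∈ insert f F, Function.update τ f 1 g = 1 ∨ Function.update τ f 1 g = 2 := by
        intro g hg
        by_cases h : g = f
        · subst h; simp
        · rw [Function.update_of_ne h]
          exact hτ g (Finset.mem_of_mem_insert_of_ne hg h)
      have hτ2 : ∀ g ∈ insert f F, Function.update τ f 2 g = 1 ∨ Function.update τ f 2 g = 2 := by
        intro g hg
        by_cases h : g = f
        · subst h; simp
        · rw [Function.update_of_ne h]
          exact hτ g (Finset.mem_of_mem_insert_of_ne hg h)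
      have hc0 : (triFracFree (Function.update p f 0) F).card = ((triFracFree p F).erase f).card := by
        rw [triFracFree_update p F f 0 (Or.inl rfl)]
      have hc1 : (triFracFree (Function.update p f 1) F).card = ((triFracFree p F).erase f).card := by
        rw [triFracFree_update p F f 1 (Or.inr rfl)]
      have hc2 : (triFracFree p (insert f F)).card = ((triFracFree p F).erase f).card := by
        rw [triFracFree_insert]
      have heF : e ∈ insert f F := Finset.mem_insert_of_mem he
      have hA := ih _ hlt (Function.update p f 0) (hp.update f le_rfl zero_le_one) F τ he hτe hτ hc0
      have hB := ih _ hlt (Function.update p f 1) (hp.update f zero_le_one le_rfl) F τ he hτe hτ hc1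
      have hC := ih _ hlt p hp (insert f F) (Function.update τ f 1) heF
        (by rw [Function.update_of_ne hef]; exact hτe) hτ1 hc2
      have hD := ih _ hlt p hp (insert f F) (Function.update τ f 2) heF
        (by rw [Function.update_of_ne hef]; exact hτe) hτ2 hc2
      rw [Function.update_of_ne hef] at hA hB
      have hq0 : 0 ≤ (1 - p f) ^ 3 := pow_nonneg (sub_nonneg.mpr (hp.le_one f)) 3
      have hq1 : 0 ≤ p f ^ 3 := pow_nonneg (hp.nonneg f) 3
      have hA' := mul_le_mul_of_nonneg_left hA hq0
      have hB' := mul_le_mul_of_nonneg_left hB hq1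
      linarith

/-- **(ROW-23) implies (W-ROW-23)**: the typed row on every minor gives the weighted one-edge row. -/
theorem wrow23_of_row23 (h23 : Row23 (R := R) ends o a₁ a₂ a₃ b) :
    WRow23 (R := R) ends o a₁ a₂ a₃ b := by
  intro p hp e τ
  have h := wrow23_aux ends o a₁ a₂ a₃ b h23 p hp {e} (Function.update τ e 2) e
    (Finset.mem_singleton_self e) (Function.update_self _ _ _)
    (fun f hf => by rw [Finset.mem_singleton.mp hf, Function.update_self]; exact Or.inr rfl)
  rw [Finset.erase_singleton, ← hcov_cubic] at h
  exact h

end OfTyped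

end WRows

end CovForm

end Summit.Ventures.PercRepro2
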